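import Summits.CriticalPhenomena.SAWScalingLimit.Theorems.SAWReversalUpgradePathUpgradeRDetMa
import Summits.CriticalPhenomena.SAWScalingLimit.Theorems.SAWReversalUpgradePathUpgradeRDetMb
import Summits.CriticalPhenomena.SAWScalingLimit.Theorems.SAWReversalUpgradePathUpgradeRDetShadow
import Summits.CriticalPhenomena.SAWScalingLimit.Theorems.SAWReversalUpgradePathUpgradeRSLEHullPackage
import Summits.CriticalPhenomena.SAWScalingLimit.Theorems.SAWReversalUpgradePathUpgradeRHullHausdorff
import Literature.Probability.RandomPlanarGeometry.CritPercSLESimplePathHolds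
import Literature.Probability.RandomPlanarGeometry.LocalMartingaleProofs
import HarnessLib

/-!
# `PathUpgradeR`, line `bidir_windows`, the lead's stub `stub_returnsDie` — layer 3a: the SLE side
(crux stmt-CriticalPhenomena-18055, route `SAWReversalUpgrade`)

The bad driver set `A₀ = {W'|[0,T+2] : no reference curve ρ makes (W', ρ) GOOD}` is charged by the
law of the SLE(8/3) driver `V = √(8/3) B` only through the IRREGULAR samples: if the sample `ω` has
all the deterministic margins (moduli of the reference `r = ψ̄ ∘ γ`, `γ = sleTrace ω`, oscillation of
`V`, conformal height of far points, interior and start clauses) and the a.s. qualitative structure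
(simple generating trace, `closure K_t = γ[0,t]`, sup-norm continuity of `W ↦ ψ̄ (closure K_q(W))` at
`V` for rational `q`), then for SOME `δ₀(ω) > 0` every continuous `W'` `δ₀`-close to `V` on
`[0, T+2]` is GOOD with the reference `ρ := γ` (`stub_detShadow`, `stub_detMa`, `stub_detMb`), so
`V|[0,T+2] ∉ closure A₀`. Hence `P' {V|[0,T+2] ∈ closure A₀} ≤ P' B` for any set `B` off which the
margins hold (`PathUpgradeRSLEGood.measure_closure_badDrivers_le`; `δ₀` is existential per sample, so
no measurability is needed). Registered auxiliary stub: `stub_returnsDie_sleGood` (closure of the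
hulls equals the trace image at all times once it does at rational times). [folklore]
-/

noncomputable section

open Set Filter Metric Topology MeasureTheory
open scoped NNReal
open UpperHalfPlane (upperHalfPlaneSet)

namespace Summit.CriticalPhenomena.SAWScalingLimit.Theorems

open Literature.Probability Literature.Probability.RandomPlanarGeometry
open Literature.Probability.RandomPlanarGeometry.Loewner

namespace PathUpgradeRSLEGood

/-- If `closure (K_q) = γ[0,q]` at every positive RATIONAL time `q` (γ continuous injective), then
`closure (K_t) = γ[0,t]` at every positive time (hulls increase, `γ` is continuous). [folklore] -/
theorem closure_hull_eq_of_rat (V : ℝ≥0 → ℝ) (γ : ℝ≥0 → ℂ) (hγc : Continuous γ)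
    (hinj : Function.Injective γ)
    (h : ∀ q : ℚ, 0 < (q : ℝ) → closure (hull V (Real.toNNReal q)) = γ '' Icc 0 (Real.toNNReal q)) :
    ∀ t : ℝ≥0, 0 < t → closure (hull V t) = γ '' Icc 0 t := by
  intro t ht
  have ht' : (0 : ℝ) < t := by exact_mod_cast ht
  -- points of `closure K_t` are `γ s` with `s ≤ q` for every rational `q > t`
  have key : ∀ z ∈ closure (hull V t), ∀ q : ℚ, (t : ℝ) < q →
      ∃ s : ℝ≥0, (s : ℝ) ≤ q ∧ γ s = z := by
    intro z hz q hq
    have hq0 : (0 : ℝ) < q := ht'.trans hq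
    have hle : t ≤ Real.toNNReal q := by
      rw [← NNReal.coe_le_coe, Real.coe_toNNReal _ hq0.le]
      exact hq.le
    have hz' := closure_mono (hull_mono V hle) hz
    rw [h q hq0] at hz'
    obtain ⟨s, hs, hsz⟩ := hz'
    refine ⟨s, ?_, hsz⟩
    have := hs.2
    rw [← NNReal.coe_le_coe, Real.coe_toNNReal _ hq0.le] at this
    exact this
  apply Subset.antisymm
  · intro z hz
    obtain ⟨q₀, hq₀⟩ := exists_rat_gt (t : ℝ)
    obtain ⟨s₀, -, hs₀⟩ := key z hz q₀ hq₀
    refine ⟨s₀, ⟨bot_le, ?_⟩, hs₀⟩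
    by_contra hlt
    push Not at hlt
    obtain ⟨q, htq, hqs⟩ := exists_rat_btwn (show (t : ℝ) < s₀ by exact_mod_cast hlt)
    obtain ⟨s, hs, hsz⟩ := key z hz q htq
    have hss : s = s₀ := hinj (hsz.trans hs₀.symm)
    rw [hss] at hs
    linarith
  · rintro z ⟨s, hs, rfl⟩
    have hIco : γ '' Ico 0 t ⊆ closure (hull V t) := by
      rintro _ ⟨u, hu, rfl⟩
      obtain ⟨q, huq, hqt⟩ := exists_rat_btwn (show (u : ℝ) < t by exact_mod_cast hu.2)
      have hq0 : (0 : ℝ) < q := lt_of_le_of_lt u.2 huq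
      have hle : Real.toNNReal q ≤ t := by
        rw [← NNReal.coe_le_coe, Real.coe_toNNReal _ hq0.le]
        exact hqt.le
      have hmem : γ u ∈ γ '' Icc 0 (Real.toNNReal q) := by
        refine ⟨u, ⟨bot_le, ?_⟩, rfl⟩
        rw [← NNReal.coe_le_coe, Real.coe_toNNReal _ hq0.le]
        exact huq.le
      rw [← h q hq0] at hmem
      exact closure_mono (hull_mono V hle) hmem
    rcases hs.2.lt_or_eq with hlt | heq
    · exact hIco ⟨s, ⟨hs.1, hlt⟩, rfl⟩
    · subst heq
      have hcl : s ∈ closure (Ico (0 : ℝ≥0) s) := by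
        rw [closure_Ico ht.ne]
        exact ⟨bot_le, le_rfl⟩
      have h1 : γ s ∈ closure (γ '' Ico 0 s) :=
        hγc.continuousWithinAt.mem_closure_image hcl
      exact closure_minimal hIco isClosed_closure h1

/-- **The SLE side of `stub_returnsDie`.** See the module docstring: off the bad set `B` (where the
margins and the extra reference property `X` hold), a sample `ω` whose restricted driver lies in the
closure of the bad-driver set `A₀` would, for a small enough `δ₀(ω)`, admit a `δ₀`-close driver `W'`
with no GOOD reference — but `ρ := sleTrace ω` is one (`stub_detShadow`, `stub_detMa`, `stub_detMb`,
oscillation by the triangle inequality, the other clauses being the margins themselves); so the event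
is contained in `B` up to a null set. [folklore] -/
theorem measure_closure_badDrivers_le : ∀ (E : Literature.Probability.RandomPlanarGeometry.DobrushinDomain) (ψ : Literature.Probability.RandomPlanarGeometry.ConformalEquiv UpperHalfPlane.upperHalfPlaneSet E.carrier), E.IsChordalUniformizing ψ → ∀ (T : NNReal), 0 < T → ∀ (ε μ μ₀ w c₀ θ ρ₁ m₁ d' h₀ α₀ dB raP L la csh ρS ρM : ℝ), 0 < ε → 0 < csh → 0 < θ → 2 * θ ≤ la → la ≤ 1 → la = L * θ → 0 < ρ₁ → 0 ≤ ρM → ρM ≤ Real.sqrt la / 200 → Real.sqrt θ ≤ Real.sqrt la / 400 → m₁ ≤ Real.sqrt la / 40 → 0 < d' → 0 < h₀ → ρS ≤ raP - ε → ∀ (X : (NNReal → ℂ) → Prop) (B : Set (NNReal → ℝ)), (∀ ω : NNReal → ℝ, ω ∉ B → ((∀ s t : NNReal, (s : ℝ) ≤ T + 2 → (t : ℝ) ≤ T + 2 → |(s : ℝ) - t| ≤ csh → dist (ψ.boundaryExtension (Literature.Probability.RandomPlanarGeometry.sleTrace ((8:NNReal)/3) ω s)) (ψ.boundaryExtension (Literature.Probability.RandomPlanarGeometry.sleTrace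 ((8:NNReal)/3) ω t)) < ε / 4) ∧ (∀ s t : NNReal, (s : ℝ) ≤ T + 1 → (t : ℝ) ≤ T + 1 → w ≤ |(s : ℝ) - t| → μ ≤ dist (ψ.boundaryExtension (Literature.Probability.RandomPlanarGeometry.sleTrace ((8:NNReal)/3) ω s)) (ψ.boundaryExtension (Literature.Probability.RandomPlanarGeometry.sleTrace ((8:NNReal)/3) ω t))) ∧ (∀ s t : NNReal, (s : ℝ) ≤ T + 1 → (t : ℝ) ≤ T + 1 → c₀ / 4 ≤ |(s : ℝ) - t| → μ₀ ≤ dist (ψ.boundaryExtension (Literature.Probability.RandomPlanarGeometry.sleTrace ((8:NNReal)/3) ω s)) (ψ.boundaryExtension (Literature.Probability.RandomPlanarGeometry.sleTrace ((8:NNReal)/3) ω t))) ∧ (∀ s s' : NNReal, (s : ℝ) ≤ T + 1 → (s' : ℝ) ≤ T + 1 → |(s : ℝ) - s'| ≤ θ + 4 * w → |Literature.Probability.RandomPlanarGeometry.sleDriving ((8:NNReal)/3) ω s - Literature.Probability.RandomPlanarGeometry.sleDriving ((8:NNReal)/3) ω s'| ≤ ρ₁ / 2) ∧ (∀ s s'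 : NNReal, (s : ℝ) ≤ T + 1 → (s' : ℝ) ≤ T + 1 → |(s : ℝ) - s'| ≤ θ → |Literature.Probability.RandomPlanarGeometry.sleDriving ((8:NNReal)/3) ω s - Literature.Probability.RandomPlanarGeometry.sleDriving ((8:NNReal)/3) ω s'| ≤ ρM) ∧ (∀ e ∈ E.carrier, d' ≤ Metric.infDist e ((fun v => ψ.boundaryExtension (Literature.Probability.RandomPlanarGeometry.sleTrace ((8:NNReal)/3) ω v)) '' Set.Icc 0 (T + 1) ∪ frontier E.carrier) → ((T : NNReal) : WithTop NNReal) < Literature.Probability.RandomPlanarGeometry.Loewner.swallowingTime (Literature.Probability.RandomPlanarGeometry.sleDriving ((8:NNReal)/3) ω) (ψ.symm e) ∧ 2 * h₀ ≤ (Literature.Probability.RandomPlanarGeometry.Loewner.map (Literature.Probability.RandomPlanarGeometry.sleDriving ((8:NNReal)/3) ω) T (ψ.symm e)).im) ∧ (∀ u : NNReal, α₀ / 2 ≤ (u : ℝ) → (u : ℝ) ≤ T + 1 → dB ≤ Metric.infDist (ψ.boundaryExtension (Literature.Probability.RandomPlanarGeometry.sleTrace ((8:NNReal)/3) ω u)) (frontier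 E.carrier)) ∧ (∀ u : NNReal, (u : ℝ) ≤ α₀ → dist (ψ.boundaryExtension (Literature.Probability.RandomPlanarGeometry.sleTrace ((8:NNReal)/3) ω u)) (E.pt 0) < ρS) ∧ X (Literature.Probability.RandomPlanarGeometry.sleTrace ((8:NNReal)/3) ω))) → Literature.Probability.Process.preWienerMeasure {ω | ((⟨Literature.Probability.RandomPlanarGeometry.sleDriving ((8:NNReal)/3) ω, Literature.Probability.RandomPlanarGeometry.continuous_sleDriving ((8:NNReal)/3) ω⟩ : C(NNReal, ℝ)).restrict (Set.Icc (0:NNReal) (T + 2))) ∈ closure {wr : C((Set.Icc (0:NNReal) (T + 2)), ℝ) | ∃ (W' : NNReal → ℝ) (hW' : Continuous W'), (⟨W', hW'⟩ : C(NNReal, ℝ)).restrict (Set.Icc (0:NNReal) (T + 2)) = wr ∧ ∀ ρ : NNReal → ℂ, ¬ ((Continuous ρ ∧ (∀ u : NNReal, 0 ≤ (ρ u).im) ∧ ρ 0 = 0 ∧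
  (∀ t : NNReal, 0 < t → (t : ℝ) ≤ T + 1 →
    Metric.hausdorffDist (ψ.boundaryExtension '' closure (Literature.Probability.RandomPlanarGeometry.Loewner.hull W' t))
      ((fun u => ψ.boundaryExtension (ρ u)) '' Set.Icc 0 t) ≤ ε) ∧
  (∀ s t : NNReal, (s : ℝ) ≤ T + 1 → (t : ℝ) ≤ T + 1 → w ≤ |(s : ℝ) - t| →
    μ ≤ dist (ψ.boundaryExtension (ρ s)) (ψ.boundaryExtension (ρ t))) ∧
  (∀ s t : NNReal, (s : ℝ) ≤ T + 1 → (t : ℝ) ≤ T + 1 → c₀ / 4 ≤ |(s : ℝ) - t| →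
    μ₀ ≤ dist (ψ.boundaryExtension (ρ s)) (ψ.boundaryExtension (ρ t))) ∧
  (∀ s s' : NNReal, (s : ℝ) ≤ T + 1 → (s' : ℝ) ≤ T + 1 → |(s : ℝ) - s'| ≤ θ + 4 * w →
    |W' s - W' s'| ≤ ρ₁) ∧
  (∀ t₁ : NNReal, (t₁ : ℝ) ≤ T → ∃ u : NNReal, (t₁ : ℝ) + 2 * θ ≤ u ∧ (u : ℝ) ≤ t₁ + L * θ ∧
    ρ u ∈ Literature.Probability.RandomPlanarGeometry.Loewner.domain W' t₁ ∧
    m₁ ≤ ‖Literature.Probability.RandomPlanarGeometry.Loewner.map W' t₁ (ρ u) - W' t₁‖) ∧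
  (∀ t₁ : NNReal, (t₁ : ℝ) ≤ T → ∀ e ∈ E.carrier,
    d' ≤ Metric.infDist e ((fun u => ψ.boundaryExtension (ρ u)) '' Set.Icc 0 (T + 1) ∪ frontier E.carrier) →
    ψ.symm e ∈ Literature.Probability.RandomPlanarGeometry.Loewner.domain W' t₁ ∧
    h₀ ≤ (Literature.Probability.RandomPlanarGeometry.Loewner.map W' t₁ (ψ.symm e)).im) ∧
  (∀ u : NNReal, α₀ / 2 ≤ (u : ℝ) → (u : ℝ) ≤ T + 1 →
    dB ≤ Metric.infDist (ψ.boundaryExtension (ρ u)) (frontier E.carrier)) ∧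
  (∀ u : NNReal, (u : ℝ) ≤ T + 1 → (u : ℝ) < α₀ →
    dist (ψ.boundaryExtension (ρ u)) (E.pt 0) < raP - ε)) ∧ X ρ)}} ≤ Literature.Probability.Process.preWienerMeasure B := by
  intro E ψ hψ T hT ε μ μ₀ w c₀ θ ρ₁ m₁ d' h₀ α₀ dB raP L la csh ρS ρM hε hcsh hθ h2θ hla hlaL hρ₁ hρM0
    hρM hsqθ hm₁ hd' hh₀ hρS X B hB
  haveI : IsProbabilityMeasure Process.preWienerMeasure := isProbabilityMeasure_preWienerMeasure'
  have hκ0 : (0 : ℝ≥0) < (8 : ℝ≥0) / 3 := by positivity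
  have hκ4 : (8 : ℝ≥0) / 3 ≤ 4 := by
    rw [div_le_iff₀ (by norm_num : (0 : ℝ≥0) < 3)]
    norm_num
  have hPK := stub_sleHullPackage stub_hullHausdorff E ψ hψ
  have hae1 := ae_isGeneratedByCurve_sleTrace hasSLETrace_eightThirds
  have hae2 := ae_isSimpleTrace_sleTrace_of_le_four_apply hκ0 hκ4
  have hae3 : ∀ᵐ ω ∂Process.preWienerMeasure, ∀ q : ℚ, 0 < (q : ℝ) →
      closure (hull (sleDriving ((8 : ℝ≥0) / 3) ω) (Real.toNNReal q)) =
          sleTrace ((8 : ℝ≥0) / 3) ω '' Icc 0 (Real.toNNReal q) ∧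
        ∀ ε' : ℝ, 0 < ε' → ∃ ρ : ℝ, 0 < ρ ∧ ∀ W' : ℝ≥0 → ℝ, Continuous W' →
          (∀ s : ℝ≥0, s ≤ Real.toNNReal q → |W' s - sleDriving ((8 : ℝ≥0) / 3) ω s| ≤ ρ) →
          hausdorffDist (ψ.boundaryExtension '' closure (hull W' (Real.toNNReal q)))
            (ψ.boundaryExtension '' closure (hull (sleDriving ((8 : ℝ≥0) / 3) ω) (Real.toNNReal q)))
              ≤ ε' := by
    rw [ae_all_iff]
    intro q
    by_cases hq : 0 < (q : ℝ)
    · have hq' : (0 : ℝ≥0) < Real.toNNReal q := Real.toNNReal_pos.2 hq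
      filter_upwards [hPK.1 (Real.toNNReal q) hq'] with ω hω _
      exact hω
    · exact ae_of_all _ fun ω h ↦ absurd h hq
  refine measure_mono_ae ?_
  filter_upwards [hae1, hae2, hae3] with ω hgen hsimple hrat hZ
  by_contra hωB
  obtain ⟨m1, m2, m3, m4, m5, m6, m7, m8, mX⟩ := hB ω hωB
  set V : ℝ≥0 → ℝ := sleDriving ((8 : ℝ≥0) / 3) ω with hV
  set γ : ℝ≥0 → ℂ := sleTrace ((8 : ℝ≥0) / 3) ω with hγ
  have hVc : Continuous V := continuous_sleDriving _ ω
  -- closure of the hulls = trace image, at all times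
  have hcl : ∀ t : ℝ≥0, 0 < t → closure (hull V t) = γ '' Icc 0 t :=
    closure_hull_eq_of_rat V γ (continuous_sleTrace _ ω) hsimple.1 fun q hq ↦ (hrat q hq).1
  -- the three perturbation lemmas
  have hcontq : ∀ q : ℝ≥0, 0 < q → (q : ℝ) ≤ T + 2 → (∃ z : ℚ, (q : ℝ) = z) → ∀ ε' : ℝ, 0 < ε' →
      ∃ ρ : ℝ, 0 < ρ ∧ ∀ W' : ℝ≥0 → ℝ, Continuous W' → (∀ s : ℝ≥0, s ≤ q → |W' s - V s| ≤ ρ) →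
        hausdorffDist (ψ.boundaryExtension '' closure (hull W' q))
          (ψ.boundaryExtension '' closure (hull V q)) ≤ ε' := by
    rintro q hq - ⟨z, hz⟩ ε' hε'
    have hz0 : 0 < (z : ℝ) := by rw [← hz]; exact_mod_cast hq
    have hqz : Real.toNNReal z = q := by rw [← hz, Real.toNNReal_coe]
    have := (hrat z hz0).2 ε' hε'
    rwa [hqz] at this
  obtain ⟨δ₁, hδ₁, H1⟩ := stub_detShadow E ψ hψ V γ hVc hgen hsimple hcl T ε csh hε hcsh m1 hcontq
  obtain ⟨δ₂, hδ₂, H2⟩ := stub_detMa V γ hVc hgen hsimple hcl T θ la ρM hθ h2θ hla hρM0 hρM hsqθ m5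
  obtain ⟨δ₃, hδ₃, H3⟩ := stub_detMb E ψ hψ V γ hVc hgen hsimple T hT (hcl T hT) d' h₀ hd' hh₀ m6
  set δ₀ : ℝ := min (min δ₁ δ₂) (min δ₃ (ρ₁ / 4)) with hδ₀
  have hδ₀pos : 0 < δ₀ := lt_min (lt_min hδ₁ hδ₂) (lt_min hδ₃ (by linarith))
  have hδ₀1 : δ₀ ≤ δ₁ := (min_le_left _ _).trans (min_le_left _ _)
  have hδ₀2 : δ₀ ≤ δ₂ := (min_le_left _ _).trans (min_le_right _ _)
  have hδ₀3 : δ₀ ≤ δ₃ := (min_le_right _ _).trans (min_le_left _ _)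
  have hδ₀4 : δ₀ ≤ ρ₁ / 4 := (min_le_right _ _).trans (min_le_right _ _)
  -- a bad driver `δ₀`-close to `V`
  change ((⟨sleDriving ((8 : ℝ≥0) / 3) ω, continuous_sleDriving ((8 : ℝ≥0) / 3) ω⟩ : C(ℝ≥0, ℝ)).restrict
    (Icc (0 : ℝ≥0) (T + 2))) ∈ closure _ at hZ
  rw [Metric.mem_closure_iff] at hZ
  obtain ⟨wr, ⟨W', hW'c, hrestr, hbad⟩, hdist⟩ := hZ δ₀ hδ₀pos
  have hclose : ∀ s : ℝ≥0, (s : ℝ) ≤ T + 2 → |W' s - V s| ≤ δ₀ := by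
    intro s hs
    have hsI : s ∈ Icc (0 : ℝ≥0) (T + 2) := ⟨bot_le, by exact_mod_cast hs⟩
    have h0 : ∀ (f g : C(↥(Icc (0 : ℝ≥0) (T + 2)), ℝ)) (x : ↥(Icc (0 : ℝ≥0) (T + 2))),
        dist (f x) (g x) ≤ dist f g := fun f g x ↦ ContinuousMap.dist_apply_le_dist x
    have h1 := h0 (((⟨sleDriving ((8 : ℝ≥0) / 3) ω, continuous_sleDriving ((8 : ℝ≥0) / 3) ω⟩ :
      C(ℝ≥0, ℝ)).restrict (Icc (0 : ℝ≥0) (T + 2)))) wr ⟨s, hsI⟩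
    rw [← hrestr] at h1 hdist
    simp only [ContinuousMap.restrict_apply, ContinuousMap.coe_mk] at h1
    rw [abs_sub_comm, ← Real.dist_eq]
    exact h1.trans hdist.le
  have hclose2 : ∀ s : ℝ≥0, (s : ℝ) ≤ T + 2 → |W' s - V s| ≤ δ₁ := fun s hs ↦ (hclose s hs).trans hδ₀1
  have hclose1 : ∀ s : ℝ≥0, (s : ℝ) ≤ T + 1 → |W' s - V s| ≤ δ₀ :=
    fun s hs ↦ hclose s (by linarith)
  refine hbad γ ⟨⟨continuous_sleTrace _ ω, sleTrace_im_nonneg _ ω, sleTrace_zero _ ω,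
    H1 W' hW'c hclose2, m2, m3, ?_, ?_, H3 W' hW'c (fun s hs ↦ (hclose1 s hs).trans hδ₀3), m7, ?_⟩, mX⟩
  · -- oscillation of `W'`
    intro s s' hs hs' hss'
    have h1 := hclose1 s hs
    have h2 := hclose1 s' hs'
    have h3 := m4 s s' hs hs' hss'
    have : |W' s - W' s'| ≤ |W' s - V s| + |V s - V s'| + |W' s' - V s'| := by
      have := abs_sub_le (W' s) (V s) (W' s')
      have := abs_sub_le (V s) (V s') (W' s')
      rw [abs_sub_comm (V s') (W' s')] at this
      linarith
    linarith
  · -- the conformally far gate point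
    intro t₁ ht₁
    obtain ⟨u, hu1, hu2, hdom, hfar⟩ := H2 W' hW'c (fun s hs ↦ (hclose1 s hs).trans hδ₀2) t₁ ht₁
    refine ⟨u, hu1, ?_, hdom, hm₁.trans hfar⟩
    rw [hlaL] at hu2
    exact hu2
  · -- the start clause
    intro u _ hu
    exact (m8 u hu.le).trans_le hρS

end PathUpgradeRSLEGood

/-- Registered auxiliary stub `stub_returnsDie_sleGood` of crux stmt-CriticalPhenomena-18055 (line `bidir_windows`):
closure of the Loewner hulls equals the trace image at all positive times once it does at all positive
rational times (`PathUpgradeRSLEGood.closure_hull_eq_of_rat`). [folklore] -/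
theorem stub_returnsDie_sleGood : ∀ (V : NNReal → ℝ) (γ : NNReal → ℂ), Continuous γ → Function.Injective γ → (∀ q : ℚ, 0 < (q : ℝ) → closure (Literature.Probability.RandomPlanarGeometry.Loewner.hull V (Real.toNNReal q)) = γ '' Set.Icc 0 (Real.toNNReal q)) → ∀ t : NNReal, 0 < t → closure (Literature.Probability.RandomPlanarGeometry.Loewner.hull V t) = γ '' Set.Icc 0 t :=
  fun V γ hγc hinj h => PathUpgradeRSLEGood.closure_hull_eq_of_rat V γ hγc hinj h

end Summit.CriticalPhenomena.SAWScalingLimit.Theorems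

end
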